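import Mathlib
import Literature.Computability.MetaComplexity.SmolenskyDimensionBound

/-!
# Reed–Muller duality, the hard inclusion: `RM(k,n)^⊥ ⊆ RM(n−k−1,n)`

The orthogonal complement of `RM(k,n) = lowDeg (ZMod 2) n k` (Smolensky's degree filtration: the
span of the multilinear monomials `x_S`, `|S| ≤ k`, as functions on the cube `{0,1}ⁿ`) under the
dot product `Σ_b u(b) f(b)` over `𝔽₂` lies in `RM(n−k−1,n)` — the hard half of
`RM(k,n)^⊥ = RM(n−k−1,n)` (MacWilliams–Sloane Ch. 13 §3 / Carlet 2020 §4.1). Wave-3 support of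
line Sketch/LAR (duality of annihilator ranks), crux stmt-QuantumAdvantage-1392.

Elementary proof: expand `u = Σ_T c_T x_T` in monomials (they span, `span_range_mono_eq_top`).
The pairing of two monomials is `Σ_b x_T(b) x_S(b) = Σ_b x_{T ∪ S}(b) = 2^{n − |T ∪ S|}`, which in
`𝔽₂` is the indicator `[T ∪ S = [n]]`; hence orthogonality of `u` to `x_S`, `|S| ≤ k`, reads
`Σ_{T : T ∪ S = [n]} c_T = 0`, i.e. `Σ_{T ⊇ Sᶜ} c_T = 0`. Taking `S = Tᶜ` and inducting downward
on `T` (all strict supersets of `T` have smaller complements) every coefficient `c_T` with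
`|Tᶜ| ≤ k`, i.e. `|T| ≥ n − k = k' + 1`, vanishes, so `u` is a combination of monomials of degree
`≤ k'`.
-/

namespace Summit.QuantumAdvantage.DigitPolyUniformity.SketchLAR

open Finset Module
open Literature.Computability.MetaComplexity.Smolensky (CubeFn mono lowDeg)

namespace OrthLeLowDeg

/-- The number of points of the cube `{0,1}ⁿ` above `U` (all bits in `U` set) is `2^{|Uᶜ|}`.
[folklore] -/
theorem card_filter_forall_mem {n : ℕ} (U : Finset (Fin n)) :
    (univ.filter fun b : Fin n → Bool => ∀ i ∈ U, b i = true).card = 2 ^ Uᶜ.card := by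
  have h : (univ.filter fun b : Fin n → Bool => ∀ i ∈ U, b i = true) =
      Fintype.piFinset fun i => if i ∈ U then {true} else univ := by
    ext b
    simp only [Finset.mem_filter, Finset.mem_univ, true_and, Fintype.mem_piFinset]
    refine ⟨fun hb i => ?_, fun hb i hi => ?_⟩
    · by_cases hi : i ∈ U
      · rw [if_pos hi, hb i hi]
        exact Finset.mem_singleton_self _
      · rw [if_neg hi]
        exact Finset.mem_univ _
    · have h := hb i
      rw [if_pos hi, Finset.mem_singleton] at h
      exact h
  have hc : ∀ i : Fin n, (if i ∈ U then ({true} : Finset Bool) else univ).card =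
      if i ∈ Uᶜ then 2 else 1 := by
    intro i
    by_cases hi : i ∈ U
    · rw [if_pos hi, if_neg (fun h => (Finset.mem_compl.1 h) hi), Finset.card_singleton]
    · rw [if_neg hi, if_pos (Finset.mem_compl.2 hi), Finset.card_univ, Fintype.card_bool]
  rw [h, Fintype.card_piFinset, Finset.prod_congr rfl fun i _ => hc i, Fintype.prod_ite_mem,
    Finset.prod_const]

/-- `Σ_b x_U(b) = [U = [n]]` in `𝔽₂`: the `2^{|Uᶜ|}` points of the cube above `U` are counted
modulo `2`. [folklore] -/
theorem sum_mono_eq_ite {n : ℕ} (U : Finset (Fin n)) :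
    ∑ b : Fin n → Bool, mono (ZMod 2) U b = if U = univ then 1 else 0 := by
  simp_rw [Literature.Computability.MetaComplexity.Smolensky.mono_apply]
  rw [Finset.sum_boole, card_filter_forall_mem, Nat.cast_pow, Nat.cast_ofNat,
    show (2 : ZMod 2) = 0 from by decide]
  by_cases hU : U = univ
  · rw [if_pos hU, hU, Finset.compl_univ, Finset.card_empty, pow_zero]
  · rw [if_neg hU, zero_pow]
    rwa [Ne, Finset.card_eq_zero, Finset.compl_eq_empty_iff]

/-- The pairing of two monomials over `𝔽₂`: `Σ_b x_T(b) x_S(b) = [T ∪ S = [n]]`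
(`x_T x_S = x_{T ∪ S}` on the cube). [folklore] -/
theorem sum_mono_mul_mono {n : ℕ} (T S : Finset (Fin n)) :
    ∑ b : Fin n → Bool, mono (ZMod 2) T b * mono (ZMod 2) S b =
      if T ∪ S = univ then 1 else 0 := by
  have h : ∀ b : Fin n → Bool,
      mono (ZMod 2) T b * mono (ZMod 2) S b = mono (ZMod 2) (T ∪ S) b := fun b => by
    rw [← Pi.mul_apply, Literature.Computability.MetaComplexity.Smolensky.mono_mul]
  simp_rw [h]
  exact sum_mono_eq_ite (T ∪ S)

/-- Pairing an expansion `Σ_T c_T x_T` with the monomial `x_S` picks out the coefficient sum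
`Σ_{T : T ∪ S = [n]} c_T`. [folklore] -/
theorem sum_expansion_mul_mono {n : ℕ} (c : Finset (Fin n) → ZMod 2) (S : Finset (Fin n)) :
    ∑ b : Fin n → Bool, (∑ T, c T • mono (ZMod 2) T) b * mono (ZMod 2) S b =
      ∑ T ∈ univ.filter (fun T => T ∪ S = univ), c T := by
  simp only [Finset.sum_apply, Pi.smul_apply, smul_eq_mul, Finset.sum_mul]
  rw [Finset.sum_comm, Finset.sum_filter]
  refine Finset.sum_congr rfl fun T _ => ?_
  simp_rw [mul_assoc]
  rw [← Finset.mul_sum, sum_mono_mul_mono, mul_ite, mul_one, mul_zero]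

/-- `T' ∪ Tᶜ = [n]` iff `T ⊆ T'`. [folklore] -/
theorem union_compl_eq_univ_iff {n : ℕ} (T' T : Finset (Fin n)) :
    T' ∪ Tᶜ = univ ↔ T ⊆ T' := by
  simp only [Finset.eq_univ_iff_forall, Finset.mem_union, Finset.mem_compl, Finset.subset_iff]
  exact forall_congr' fun i => imp_iff_or_not.symm

/-- Triangularity of the orthogonality relations: if `Σ_{T : T ∪ S = [n]} c_T = 0` for every
`|S| ≤ k`, then `c_T = 0` whenever `|Tᶜ| ≤ k` (downward induction on `T`: take `S = Tᶜ`; the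
other terms are indexed by strict supersets of `T`, which have smaller complements). [folklore] -/
theorem coeff_eq_zero {n k : ℕ} (c : Finset (Fin n) → ZMod 2)
    (hc : ∀ S : Finset (Fin n), S.card ≤ k → ∑ T ∈ univ.filter (fun T => T ∪ S = univ), c T = 0)
    (T : Finset (Fin n)) (hT : Tᶜ.card ≤ k) : c T = 0 := by
  suffices h : ∀ m : ℕ, ∀ T : Finset (Fin n), Tᶜ.card = m → m ≤ k → c T = 0 from h _ T rfl hT
  intro m
  induction m using Nat.strong_induction_on with
  | _ m ih =>
    intro T hTm hmk
    have hmem : T ∈ univ.filter (fun T' => T' ∪ Tᶜ = univ) :=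
      Finset.mem_filter.2 ⟨Finset.mem_univ _, Finset.union_compl T⟩
    calc c T = ∑ T' ∈ univ.filter (fun T' => T' ∪ Tᶜ = univ), c T' := by
          refine (Finset.sum_eq_single_of_mem T hmem fun T' hT' hne => ?_).symm
          have hss : T ⊂ T' := Finset.ssubset_iff_subset_ne.2
            ⟨(union_compl_eq_univ_iff T' T).1 (Finset.mem_filter.1 hT').2, hne.symm⟩
          have hlt : T'ᶜ.card < m :=
            (Finset.card_lt_card (Finset.compl_ssubset_compl.2 hss)).trans_eq hTm
          exact ih _ hlt T' rfl (hlt.le.trans hmk)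
      _ = 0 := hc Tᶜ (hTm.le.trans hmk)

end OrthLeLowDeg

/-- **Reed–Muller duality, the hard inclusion `RM(k,n)^⊥ ⊆ RM(n−k−1,n)`**: over `𝔽₂`, if
`u : {0,1}ⁿ → 𝔽₂` is orthogonal under the dot product `Σ_b u(b) f(b)` to every `f` of degree
`≤ k` (every `f ∈ lowDeg (ZMod 2) n k`), then `u` has degree `≤ k' = n − k − 1`
(MacWilliams–Sloane Ch. 13 §3; Carlet 2020 §4.1). Proof: the coefficients of `u` on the monomials
`x_T` with `|T| ≥ k' + 1 = n − k` vanish by the triangular orthogonality relations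
(`OrthLeLowDeg.coeff_eq_zero`). [folklore] -/
theorem stub_orth_le_lowDeg {n k k' : ℕ} (hkk' : k + k' + 1 = n) (u : CubeFn (ZMod 2) n)
    (hu : ∀ f : CubeFn (ZMod 2) n, f ∈ lowDeg (ZMod 2) n k → ∑ b : Fin n → Bool, u b * f b = 0) :
    u ∈ lowDeg (ZMod 2) n k' := by
  -- expand `u` in the monomial spanning family
  obtain ⟨c, hc⟩ : ∃ c : Finset (Fin n) → ZMod 2, ∑ T, c T • mono (ZMod 2) T = u := by
    rw [← Submodule.mem_span_range_iff_exists_fun,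
      Literature.Computability.MetaComplexity.Smolensky.span_range_mono_eq_top]
    exact Submodule.mem_top
  -- the orthogonality relations on the coefficients
  have hrel : ∀ S : Finset (Fin n), S.card ≤ k →
      ∑ T ∈ univ.filter (fun T => T ∪ S = univ), c T = 0 := by
    intro S hS
    rw [← OrthLeLowDeg.sum_expansion_mul_mono c S, hc]
    exact hu _ (Literature.Computability.MetaComplexity.Smolensky.mono_mem_lowDeg hS)
  rw [← hc]
  refine Submodule.sum_mem _ fun T _ => ?_
  by_cases hT : T.card ≤ k'
  · exact Submodule.smul_mem _ _
      (Literature.Computability.MetaComplexity.Smolensky.mono_mem_lowDeg hT)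
  · have hTc : Tᶜ.card ≤ k := by
      rw [Finset.card_compl, Fintype.card_fin]
      omega
    rw [OrthLeLowDeg.coeff_eq_zero c hrel T hTc, zero_smul]
    exact Submodule.zero_mem _

end Summit.QuantumAdvantage.DigitPolyUniformity.SketchLAR
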